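import Summits.BirchSwinnertonDyer.BirchSwinnertonDyer.Theorems.ByReductionTypeAtTwoSupersingularThetaHabitatTP2ItemsUpper
import Summits.BirchSwinnertonDyer.BirchSwinnertonDyer.Theorems.ByReductionTypeAtTwoSupersingularThetaTP2ByNameClass157113h
import Summits.BirchSwinnertonDyer.BirchSwinnertonDyer.Theorems.ByReductionTypeAtTwoSupersingularThetaTP2ByNameClass166419o
import Summits.BirchSwinnertonDyer.BirchSwinnertonDyer.Theorems.ByReductionTypeAtTwoSupersingularThetaTP2ByNameClass184041bk
import Summits.BirchSwinnertonDyer.BirchSwinnertonDyer.Theorems.ByReductionTypeAtTwoSupersingularThetaTP2ByNameClass219303i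
import Summits.BirchSwinnertonDyer.BirchSwinnertonDyer.Theorems.ByReductionTypeAtTwoSupersingularThetaTP2ByNameClass282093g
import Summits.BirchSwinnertonDyer.BirchSwinnertonDyer.Theorems.ByReductionTypeAtTwoSupersingularThetaTP2ByNameClass393129bx
import HarnessLib
-- buildfix (bf3-g30) G30-22: comment-only touch to re-dispatch the lane build (dead-lettered rc 76 (att 6-7, last 03:38/05:35 08-28) although the file and its whole closure are farm-green and the blocking root has a hub olean (lane datum: host-local stale dependency olean); no build event for 10 h); declarations byte-identical

/-!
# Crux `SupersingularRankZeroAtTwo` (item stmt-BirchSwinnertonDyer-19097, route ByReductionTypeAtTwo, rung K4): THETA-HABITAT road, UPPER-HALF CLASS DISPLAYS,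
# group B (157113h, 166419o, 184041bk, 219303i, 282093g, 393129bx) — Miller's upper bound `ord₂ #Ш(E) ≤ ord₂ #Ш_an(E)` (`MissingUpperBoundAt E 2`) from THREE route-TP2 items BY NAME (K2r0 20312 at the
# CM partner, K3 20308 and K4 20309 at `E`) and the torsion-and-`μ` transport in the kernel (21414 CLOSED) — NO `λ`, NO layer certificate, NO item 21415
# (seat `bsd-2adic-ss-1x` GEN 7, generator `work/ua2/gen_hab_upper.py`; door `…ThetaHabitatTP2ItemsUpper`)

HONEST FRAMING (cells `bsd-2adic` and `bsd-wall`; HUMAN RULINGS D-0036/D-0054/D-0074): CLASS INSTANCES, not bookings; THEOREMS ONLY — no definition, no named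
fact, no instance, no `sorry`; the three items are hypotheses; each theorem is a HALF of BSD₂ at the class, not BSD₂; closes nothing; BSD is NOT proved by any of
this. PARTITION (D-0054): X5@2 good-ss `a₂ = 0` THETA-HABITAT sub-row (19/208 r0 classes; here 157113h, 166419o, 184041bk, 219303i, 282093g, 393129bx) × `p = 2` — types-the-object-of; bears_on: K4 19097 ·
TP2 20312 · 20308 · 20309 · 21414 (closed). Per class `E` (CM partner `A`, Tschirnhaus pair and curve facts from the GEN 0–6 class files): PUB {`hmod`, `hGZK`,
`h2`} + ITEMS {`hK2`, `hK3`, `hK4`} + CERT {`hLA : L(A,1) ≠ 0`} ⟹ `∀ W = M_E ⊗ ℚ, L(W,1) ≠ 0 → MissingUpperBoundAt W 2`, via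
`SSThetaRoad.missingUpperBoundAt_two_baseChange_int_of_thetaPartnerItems_at`. Compared with the full displays `bsdp_two_<lab>_of_thetaPartnerItems` (GEN 6,
same classes): the fourth item 21415 and both layer certificates `hMTW`, `hMTA` are NOT needed for the upper half. References: [Kobayashi2003] Thm. 1.2, 4.1;
[Kato2004Asterisque] Thm. 12.4–12.5 (3); [BDKim2013] Cor. 3.15; [BDKim2009] Cor. 2.13; [PollackRubin2004] Thm. 7.3; [AbbesUllmo1996] Thm. A;
[CremonaAlgorithms1997] Table 1; [Miller2011LMS] Def. 1.1.
-/

set_option autoImplicit false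
-- the Theorems namespace of this sub repeats the summit name by design (D-0017 nested layout)
set_option linter.dupNamespace false

noncomputable section

open scoped Classical Polynomial

open CongruenceSubgroup WeierstrassCurve Literature.NumberTheory.EllipticCurves
  Literature.NumberTheory.EllipticCurves.ModularForms
  Literature.NumberTheory.EllipticCurves.Rank1Residual Literature.NumberTheory.EllipticCurves.Rank1Residual.Typed
  Literature.NumberTheory.EllipticCurves.Kobayashi2003 Literature.NumberTheory.EllipticCurves.IwasawaDual
  Literature.NumberTheory.IwasawaTheory
  ZpExtension Summit.BirchSwinnertonDyer.Rank1Residual Summit.BirchSwinnertonDyer.Rank1Residual.Supersingular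
  Summit.BirchSwinnertonDyer.Rank1Residual.X5 Summit.BirchSwinnertonDyer.Rank1Residual.X5.O1
  Summit.BirchSwinnertonDyer.Rank1Residual.X5.Instances Summit.BirchSwinnertonDyer.Rank1Residual.X1.MuLambda
  Summit.BirchSwinnertonDyer.BirchSwinnertonDyer.Theses.ThetaPartnerAtTwo
  Summit.BirchSwinnertonDyer.BirchSwinnertonDyer

namespace Summit.BirchSwinnertonDyer.BirchSwinnertonDyer.Theorems
namespace SSThetaRoad

/-- **`MissingUpperBoundAt(157113h1, 2)` — the Kato/Miller UPPER HALF on the theta habitat from K2r0/K3/K4 BY NAME** (`E = 157113h1`; CM partner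
`A = cmA27a`): PUB {`hmod`, `hGZK`, `h2`} + route TP2's OPEN items `hK2 : SignedMainConjectureCMTwoRankZero` (20312, at `A`),
`hK3 : SignedKatoDivisibilityUpToAtTwo` (20308), `hK4 : SignedControlAtTwo` (20309) BY NAME + CERT {`hLA : L(A,1) ≠ 0`} + KERNEL {torsion-and-`μ`
transport along `E[2] ≅ A[2]` (21414 CLOSED; Tschirnhaus `tschirnhaus_root_157113h1`), `E` non-CM, `A` CM}. A half of BSD₂; the three items are hypotheses;
BSD is not proved by this. [cite: Kobayashi2003, Thm. 1.2 and Thm. 4.1] [cite: Kato2004Asterisque, Thm. 12.4–12.5 (3)] [cite: BDKim2013, Cor. 3.15]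
[cite: PollackRubin2004, Thm. 7.3] [cite: AbbesUllmo1996, Thm. A] [cite: CremonaAlgorithms1997, Table 1] [cite: Miller2011LMS, Def. 1.1] -/
theorem missingUpperBoundAt_two_157113h1_of_thetaPartnerItems
    (hmod : nonempty_modularParametrizationData) (hGZK : rank_eq_analyticRank_of_analyticRank_le_one)
    (h2 : realPeriodRat_eq_unit_mul_plusPeriod_two)
    (hK2 : Summit.BirchSwinnertonDyer.BirchSwinnertonDyer.Theses.ThetaPartnerAtTwo.SignedMainConjectureCMTwoRankZero)
    (hK3 : Summit.BirchSwinnertonDyer.BirchSwinnertonDyer.Theses.ThetaPartnerAtTwo.SignedKatoDivisibilityUpToAtTwo)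
    (hK4 : Summit.BirchSwinnertonDyer.BirchSwinnertonDyer.Theses.ThetaPartnerAtTwo.SignedControlAtTwo)
    (hLA : ((⟨0, 0, 1, 0, 0⟩ : WeierstrassCurve ℤ).baseChange ℚ).entireLFunction 1 ≠ 0) :
    ∀ (W : WeierstrassCurve ℚ) [W.IsElliptic] [W.IsGloballyMinimal],
      W = ((⟨0, 0, 1, -2285565660, -42057036462382⟩ : WeierstrassCurve ℤ).baseChange ℚ) → W.entireLFunction 1 ≠ 0 → MissingUpperBoundAt W 2 := by
  intro W _ _ hW hL
  subst hW
  haveI := SSThetaRoad.isElliptic_cmA27a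
  haveI := SSThetaRoad.isGloballyMinimal_cmA27a
  exact missingUpperBoundAt_two_baseChange_int_of_thetaPartnerItems_at _ _ hmod hGZK h2 hK2 hK3 hK4
    SSColemanRoad.not_hasCM_157113h1 hL SSColemanRoad.goodSS_two_157113h1.2.2 SSColemanRoad.goodSS_two_157113h1.2.1
    SSThetaRoad.hasCM_cmA27a hLA SSThetaRoad.goodSS_two_cmA27a.2.2 SSThetaRoad.goodSS_two_cmA27a.2.1 _ _
    tschirnhaus_root_157113h1 tschirnhaus_inv_157113h1

/-- **`MissingUpperBoundAt(166419o1, 2)` — the Kato/Miller UPPER HALF on the theta habitat from K2r0/K3/K4 BY NAME** (`E = 166419o1`; CM partner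
`A = cmA741321`): PUB {`hmod`, `hGZK`, `h2`} + route TP2's OPEN items `hK2 : SignedMainConjectureCMTwoRankZero` (20312, at `A`),
`hK3 : SignedKatoDivisibilityUpToAtTwo` (20308), `hK4 : SignedControlAtTwo` (20309) BY NAME + CERT {`hLA : L(A,1) ≠ 0`} + KERNEL {torsion-and-`μ`
transport along `E[2] ≅ A[2]` (21414 CLOSED; Tschirnhaus `tschirnhaus_root_166419o1`), `E` non-CM, `A` CM}. A half of BSD₂; the three items are hypotheses;
BSD is not proved by this. [cite: Kobayashi2003, Thm. 1.2 and Thm. 4.1] [cite: Kato2004Asterisque, Thm. 12.4–12.5 (3)] [cite: BDKim2013, Cor. 3.15]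
[cite: PollackRubin2004, Thm. 7.3] [cite: AbbesUllmo1996, Thm. A] [cite: CremonaAlgorithms1997, Table 1] [cite: Miller2011LMS, Def. 1.1] -/
theorem missingUpperBoundAt_two_166419o1_of_thetaPartnerItems
    (hmod : nonempty_modularParametrizationData) (hGZK : rank_eq_analyticRank_of_analyticRank_le_one)
    (h2 : realPeriodRat_eq_unit_mul_plusPeriod_two)
    (hK2 : Summit.BirchSwinnertonDyer.BirchSwinnertonDyer.Theses.ThetaPartnerAtTwo.SignedMainConjectureCMTwoRankZero)
    (hK3 : Summit.BirchSwinnertonDyer.BirchSwinnertonDyer.Theses.ThetaPartnerAtTwo.SignedKatoDivisibilityUpToAtTwo)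
    (hK4 : Summit.BirchSwinnertonDyer.BirchSwinnertonDyer.Theses.ThetaPartnerAtTwo.SignedControlAtTwo)
    (hLA : ((⟨0, 0, 1, 0, -3516⟩ : WeierstrassCurve ℤ).baseChange ℚ).entireLFunction 1 ≠ 0) :
    ∀ (W : WeierstrassCurve ℚ) [W.IsElliptic] [W.IsGloballyMinimal],
      W = ((⟨0, 0, 1, -28946820, -59947813175⟩ : WeierstrassCurve ℤ).baseChange ℚ) → W.entireLFunction 1 ≠ 0 → MissingUpperBoundAt W 2 := by
  intro W _ _ hW hL
  subst hW
  haveI := SSThetaRoad.isElliptic_cmA741321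
  haveI := SSThetaRoad.isGloballyMinimal_cmA741321
  exact missingUpperBoundAt_two_baseChange_int_of_thetaPartnerItems_at _ _ hmod hGZK h2 hK2 hK3 hK4
    SSColemanRoad.not_hasCM_166419o1 hL SSColemanRoad.goodSS_two_166419o1.2.2 SSColemanRoad.goodSS_two_166419o1.2.1
    SSThetaRoad.hasCM_cmA741321 hLA SSThetaRoad.goodSS_two_cmA741321.2.2 SSThetaRoad.goodSS_two_cmA741321.2.1 _ _
    tschirnhaus_root_166419o1 tschirnhaus_inv_166419o1

/-- **`MissingUpperBoundAt(184041bk1, 2)` — the Kato/Miller UPPER HALF on the theta habitat from K2r0/K3/K4 BY NAME** (`E = 184041bk1`; CM partner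
`A = cmA1089a`): PUB {`hmod`, `hGZK`, `h2`} + route TP2's OPEN items `hK2 : SignedMainConjectureCMTwoRankZero` (20312, at `A`),
`hK3 : SignedKatoDivisibilityUpToAtTwo` (20308), `hK4 : SignedControlAtTwo` (20309) BY NAME + CERT {`hLA : L(A,1) ≠ 0`} + KERNEL {torsion-and-`μ`
transport along `E[2] ≅ A[2]` (21414 CLOSED; Tschirnhaus `tschirnhaus_root_184041bk1`), `E` non-CM, `A` CM}. A half of BSD₂; the three items are hypotheses;
BSD is not proved by this. [cite: Kobayashi2003, Thm. 1.2 and Thm. 4.1] [cite: Kato2004Asterisque, Thm. 12.4–12.5 (3)] [cite: BDKim2013, Cor. 3.15]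
[cite: PollackRubin2004, Thm. 7.3] [cite: AbbesUllmo1996, Thm. A] [cite: CremonaAlgorithms1997, Table 1] [cite: Miller2011LMS, Def. 1.1] -/
theorem missingUpperBoundAt_two_184041bk1_of_thetaPartnerItems
    (hmod : nonempty_modularParametrizationData) (hGZK : rank_eq_analyticRank_of_analyticRank_le_one)
    (h2 : realPeriodRat_eq_unit_mul_plusPeriod_two)
    (hK2 : Summit.BirchSwinnertonDyer.BirchSwinnertonDyer.Theses.ThetaPartnerAtTwo.SignedMainConjectureCMTwoRankZero)
    (hK3 : Summit.BirchSwinnertonDyer.BirchSwinnertonDyer.Theses.ThetaPartnerAtTwo.SignedKatoDivisibilityUpToAtTwo)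
    (hK4 : Summit.BirchSwinnertonDyer.BirchSwinnertonDyer.Theses.ThetaPartnerAtTwo.SignedControlAtTwo)
    (hLA : ((⟨0, 0, 1, 0, 30⟩ : WeierstrassCurve ℤ).baseChange ℚ).entireLFunction 1 ≠ 0) :
    ∀ (W : WeierstrassCurve ℚ) [W.IsElliptic] [W.IsGloballyMinimal],
      W = ((⟨0, 0, 1, -36440118, -92277007144⟩ : WeierstrassCurve ℤ).baseChange ℚ) → W.entireLFunction 1 ≠ 0 → MissingUpperBoundAt W 2 := by
  intro W _ _ hW hL
  subst hW
  haveI := SSThetaRoad.isElliptic_cmA1089a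
  haveI := SSThetaRoad.isGloballyMinimal_cmA1089a
  exact missingUpperBoundAt_two_baseChange_int_of_thetaPartnerItems_at _ _ hmod hGZK h2 hK2 hK3 hK4
    SSColemanRoad.not_hasCM_184041bk1 hL SSColemanRoad.goodSS_two_184041bk1.2.2 SSColemanRoad.goodSS_two_184041bk1.2.1
    SSThetaRoad.hasCM_cmA1089a hLA SSThetaRoad.goodSS_two_cmA1089a.2.2 SSThetaRoad.goodSS_two_cmA1089a.2.1 _ _
    tschirnhaus_root_184041bk1 tschirnhaus_inv_184041bk1

/-- **`MissingUpperBoundAt(219303i1, 2)` — the Kato/Miller UPPER HALF on the theta habitat from K2r0/K3/K4 BY NAME** (`E = 219303i1`; CM partner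
`A = cmA783225`): PUB {`hmod`, `hGZK`, `h2`} + route TP2's OPEN items `hK2 : SignedMainConjectureCMTwoRankZero` (20312, at `A`),
`hK3 : SignedKatoDivisibilityUpToAtTwo` (20308), `hK4 : SignedControlAtTwo` (20309) BY NAME + CERT {`hLA : L(A,1) ≠ 0`} + KERNEL {torsion-and-`μ`
transport along `E[2] ≅ A[2]` (21414 CLOSED; Tschirnhaus `tschirnhaus_root_219303i1`), `E` non-CM, `A` CM}. A half of BSD₂; the three items are hypotheses;
BSD is not proved by this. [cite: Kobayashi2003, Thm. 1.2 and Thm. 4.1] [cite: Kato2004Asterisque, Thm. 12.4–12.5 (3)] [cite: BDKim2013, Cor. 3.15]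
[cite: PollackRubin2004, Thm. 7.3] [cite: AbbesUllmo1996, Thm. A] [cite: CremonaAlgorithms1997, Table 1] [cite: Miller2011LMS, Def. 1.1] -/
theorem missingUpperBoundAt_two_219303i1_of_thetaPartnerItems
    (hmod : nonempty_modularParametrizationData) (hGZK : rank_eq_analyticRank_of_analyticRank_le_one)
    (h2 : realPeriodRat_eq_unit_mul_plusPeriod_two)
    (hK2 : Summit.BirchSwinnertonDyer.BirchSwinnertonDyer.Theses.ThetaPartnerAtTwo.SignedMainConjectureCMTwoRankZero)
    (hK3 : Summit.BirchSwinnertonDyer.BirchSwinnertonDyer.Theses.ThetaPartnerAtTwo.SignedKatoDivisibilityUpToAtTwo)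
    (hK4 : Summit.BirchSwinnertonDyer.BirchSwinnertonDyer.Theses.ThetaPartnerAtTwo.SignedControlAtTwo)
    (hLA : ((⟨0, 0, 1, 0, -1844⟩ : WeierstrassCurve ℤ).baseChange ℚ).entireLFunction 1 ≠ 0) :
    ∀ (W : WeierstrassCurve ℚ) [W.IsElliptic] [W.IsGloballyMinimal],
      W = ((⟨0, 0, 1, -2507677590, 49630702203414⟩ : WeierstrassCurve ℤ).baseChange ℚ) → W.entireLFunction 1 ≠ 0 → MissingUpperBoundAt W 2 := by
  intro W _ _ hW hL
  subst hW
  haveI := SSThetaRoad.isElliptic_cmA783225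
  haveI := SSThetaRoad.isGloballyMinimal_cmA783225
  exact missingUpperBoundAt_two_baseChange_int_of_thetaPartnerItems_at _ _ hmod hGZK h2 hK2 hK3 hK4
    SSColemanRoad.not_hasCM_219303i1 hL SSColemanRoad.goodSS_two_219303i1.2.2 SSColemanRoad.goodSS_two_219303i1.2.1
    SSThetaRoad.hasCM_cmA783225 hLA SSThetaRoad.goodSS_two_cmA783225.2.2 SSThetaRoad.goodSS_two_cmA783225.2.1 _ _
    tschirnhaus_root_219303i1 tschirnhaus_inv_219303i1

/-- **`MissingUpperBoundAt(282093g1, 2)` — the Kato/Miller UPPER HALF on the theta habitat from K2r0/K3/K4 BY NAME** (`E = 282093g1`; CM partner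
`A = cmA3249a`): PUB {`hmod`, `hGZK`, `h2`} + route TP2's OPEN items `hK2 : SignedMainConjectureCMTwoRankZero` (20312, at `A`),
`hK3 : SignedKatoDivisibilityUpToAtTwo` (20308), `hK4 : SignedControlAtTwo` (20309) BY NAME + CERT {`hLA : L(A,1) ≠ 0`} + KERNEL {torsion-and-`μ`
transport along `E[2] ≅ A[2]` (21414 CLOSED; Tschirnhaus `tschirnhaus_root_282093g1`), `E` non-CM, `A` CM}. A half of BSD₂; the three items are hypotheses;
BSD is not proved by this. [cite: Kobayashi2003, Thm. 1.2 and Thm. 4.1] [cite: Kato2004Asterisque, Thm. 12.4–12.5 (3)] [cite: BDKim2013, Cor. 3.15]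
[cite: PollackRubin2004, Thm. 7.3] [cite: AbbesUllmo1996, Thm. A] [cite: CremonaAlgorithms1997, Table 1] [cite: Miller2011LMS, Def. 1.1] -/
theorem missingUpperBoundAt_two_282093g1_of_thetaPartnerItems
    (hmod : nonempty_modularParametrizationData) (hGZK : rank_eq_analyticRank_of_analyticRank_le_one)
    (h2 : realPeriodRat_eq_unit_mul_plusPeriod_two)
    (hK2 : Summit.BirchSwinnertonDyer.BirchSwinnertonDyer.Theses.ThetaPartnerAtTwo.SignedMainConjectureCMTwoRankZero)
    (hK3 : Summit.BirchSwinnertonDyer.BirchSwinnertonDyer.Theses.ThetaPartnerAtTwo.SignedKatoDivisibilityUpToAtTwo)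
    (hK4 : Summit.BirchSwinnertonDyer.BirchSwinnertonDyer.Theses.ThetaPartnerAtTwo.SignedControlAtTwo)
    (hLA : ((⟨0, 0, 1, -342, -2437⟩ : WeierstrassCurve ℤ).baseChange ℚ).entireLFunction 1 ≠ 0) :
    ∀ (W : WeierstrassCurve ℚ) [W.IsElliptic] [W.IsGloballyMinimal],
      W = ((⟨0, -1, 1, 31451271, -719190590812⟩ : WeierstrassCurve ℤ).baseChange ℚ) → W.entireLFunction 1 ≠ 0 → MissingUpperBoundAt W 2 := by
  intro W _ _ hW hL
  subst hW
  haveI := SSThetaRoad.isElliptic_cmA3249a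
  haveI := SSThetaRoad.isGloballyMinimal_cmA3249a
  exact missingUpperBoundAt_two_baseChange_int_of_thetaPartnerItems_at _ _ hmod hGZK h2 hK2 hK3 hK4
    SSColemanRoad.not_hasCM_282093g1 hL SSColemanRoad.goodSS_two_282093g1.2.2 SSColemanRoad.goodSS_two_282093g1.2.1
    SSThetaRoad.hasCM_cmA3249a hLA SSThetaRoad.goodSS_two_cmA3249a.2.2 SSThetaRoad.goodSS_two_cmA3249a.2.1 _ _
    tschirnhaus_root_282093g1 tschirnhaus_inv_282093g1

/-- **`MissingUpperBoundAt(393129bx1, 2)` — the Kato/Miller UPPER HALF on the theta habitat from K2r0/K3/K4 BY NAME** (`E = 393129bx1`; CM partner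
`A = cmA1089e`): PUB {`hmod`, `hGZK`, `h2`} + route TP2's OPEN items `hK2 : SignedMainConjectureCMTwoRankZero` (20312, at `A`),
`hK3 : SignedKatoDivisibilityUpToAtTwo` (20308), `hK4 : SignedControlAtTwo` (20309) BY NAME + CERT {`hLA : L(A,1) ≠ 0`} + KERNEL {torsion-and-`μ`
transport along `E[2] ≅ A[2]` (21414 CLOSED; Tschirnhaus `tschirnhaus_root_393129bx1`), `E` non-CM, `A` CM}. A half of BSD₂; the three items are hypotheses;
BSD is not proved by this. [cite: Kobayashi2003, Thm. 1.2 and Thm. 4.1] [cite: Kato2004Asterisque, Thm. 12.4–12.5 (3)] [cite: BDKim2013, Cor. 3.15]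
[cite: PollackRubin2004, Thm. 7.3] [cite: AbbesUllmo1996, Thm. A] [cite: CremonaAlgorithms1997, Table 1] [cite: Miller2011LMS, Def. 1.1] -/
theorem missingUpperBoundAt_two_393129bx1_of_thetaPartnerItems
    (hmod : nonempty_modularParametrizationData) (hGZK : rank_eq_analyticRank_of_analyticRank_le_one)
    (h2 : realPeriodRat_eq_unit_mul_plusPeriod_two)
    (hK2 : Summit.BirchSwinnertonDyer.BirchSwinnertonDyer.Theses.ThetaPartnerAtTwo.SignedMainConjectureCMTwoRankZero)
    (hK3 : Summit.BirchSwinnertonDyer.BirchSwinnertonDyer.Theses.ThetaPartnerAtTwo.SignedKatoDivisibilityUpToAtTwo)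
    (hK4 : Summit.BirchSwinnertonDyer.BirchSwinnertonDyer.Theses.ThetaPartnerAtTwo.SignedControlAtTwo)
    (hLA : ((⟨0, 0, 1, -66, -212⟩ : WeierstrassCurve ℤ).baseChange ℚ).entireLFunction 1 ≠ 0) :
    ∀ (W : WeierstrassCurve ℚ) [W.IsElliptic] [W.IsGloballyMinimal],
      W = ((⟨0, 0, 1, -10745526, -15855362141⟩ : WeierstrassCurve ℤ).baseChange ℚ) → W.entireLFunction 1 ≠ 0 → MissingUpperBoundAt W 2 := by
  intro W _ _ hW hL
  subst hW
  haveI := SSThetaRoad.isElliptic_cmA1089e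
  haveI := SSThetaRoad.isGloballyMinimal_cmA1089e
  exact missingUpperBoundAt_two_baseChange_int_of_thetaPartnerItems_at _ _ hmod hGZK h2 hK2 hK3 hK4
    SSColemanRoad.not_hasCM_393129bx1 hL SSColemanRoad.goodSS_two_393129bx1.2.2 SSColemanRoad.goodSS_two_393129bx1.2.1
    SSThetaRoad.hasCM_cmA1089e hLA SSThetaRoad.goodSS_two_cmA1089e.2.2 SSThetaRoad.goodSS_two_cmA1089e.2.1 _ _
    tschirnhaus_root_393129bx1 tschirnhaus_inv_393129bx1

end SSThetaRoad
end Summit.BirchSwinnertonDyer.BirchSwinnertonDyer.Theorems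

end
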